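import Summits.KontsevichZagierPeriods.KontsevichZagierPeriods.Theorems.LinRedNormalFormArrangementNormalFormStubRebaseSimpleZeroNestedDiffE1Grid

/-!
# Stub `stub_rebaseSimpleZeroTwo`, part `rebaseSimpleZero_HDiff1_of_HPar1` (crux
`ArrangementNormalForm`, line `janus-bands`) — brick `NestedDiffE1Ends`

The SINGULAR ENDS of the interval normal form `HDiff₁` (`RebaseE1.IsDN`: clean nest
`A(y) < tᵢ < tⱼ < B(y)` over `{l < y < u}`, inner letter `cᵢ` constant, outer letter `cⱼ` of
slope `λ ≠ 0`, base pole `r` outside the open interval, base constant `K ≠ 0`), left end `l`: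
* `IsDN.pinch_of_pole` — if the pole sits at the end (`r = l`) then the band PINCHES there
  (`A(l) = B(l)`): otherwise a coordinate box `(l, l + δ) × I₁ × I₂` inside the domain carries
  the bound `(y − l)⁻¹ ≤ C |f|`, and `∫ dy/(y − l) = ∞` (`unletter_integrableOn_pi`,
  `intervalIntegrable_sub_inv_iff`);
* `IsDN.good_pinch_far` — a pinch `A(l) = B(l) = t₀` with the pole off the closed interval and
  BOTH letters off the vertex (`cᵢ ≠ t₀`, `cⱼ(l) ≠ t₀`) is good given `HPar1`: cut the base at
  `l + δ` (the right piece is regular, `IsDN.good_middle`), and on the left piece the box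
  `(t₀ − η/2, B)` keeps a margin from both letters, so the sub-section Janus at the constant
  `T = t₀ − η/2` (`IsDN.good_sub`) has a bounded box and nests with constant lower bound;
* `IsDN.good_left_of_HVertL` — hence a datum whose only singular end is the left one is good
  given `HPar1` and the residual hypothesis `HVertL`: a pinch at `l` with the pole AT the vertex
  (`r = l`) or a letter THROUGH the vertex (`cᵢ = t₀` or `cⱼ(l) = t₀`).

References: M. Kontsevich, D. Zagier, *Periods* (2001), §1.2, rules (1a), (2); D. Zagier, *Values
of zeta functions and their applications* (1994), §9.
-/

noncomputable section

open Set MeasureTheory MvPolynomial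
open Literature.NumberTheory.Transcendental Literature.ModelTheory.ExponentialFields

namespace Summit.KontsevichZagierPeriods.ArrangementNormalForm.JanusBands

namespace RebaseE1

open SeparatePos RebasePos RebaseZero RebaseNest RebaseDiff

variable {i j : Fin 2} {s : KZ.IntegralRep (0 + 1 + 2)} {l u : ℚ} {A B : Cf} {T : BData}
  {p : MvPolynomial (Fin 0) ℚ} {a : Fin 2 → Option Cf} {ci cj : Cf}

/-! ### One-variable divergence -/

/-- `x ↦ (x − l)⁻¹` is not integrable on `(l, l + δ)`. [folklore] -/
theorem not_integrableOn_sub_inv {l₀ δ : ℝ} (hδ : 0 < δ) :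
    ¬ IntegrableOn (fun x : ℝ => (x - l₀)⁻¹) (Ioo l₀ (l₀ + δ)) := by
  intro h
  have hle : l₀ ≤ l₀ + δ := by linarith
  have h' : IntervalIntegrable (fun x : ℝ => (x - l₀)⁻¹) volume l₀ (l₀ + δ) :=
    (intervalIntegrable_iff_integrableOn_Ioo_of_le hle).2 h
  rcases intervalIntegrable_sub_inv_iff.1 h' with h1 | h1
  · linarith
  · exact h1 (by rw [uIcc_of_le hle]; exact ⟨le_rfl, hle⟩)

/-- The coordinate box `∏ₖ (lo k, hi k)` with corners `pt i j`. -/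
theorem mem_box_pt (hij : i ≠ j) {y₁ y₂ a₁ a₂ b₁ b₂ : ℝ} (w : Fin (0 + 1 + 2) → ℝ) :
    w ∈ Set.pi univ (fun k => Ioo (pt i j y₁ a₁ b₁ k) (pt i j y₂ a₂ b₂ k)) ↔
      (y₁ < yv w ∧ yv w < y₂) ∧ (a₁ < tv w i ∧ tv w i < a₂) ∧ (b₁ < tv w j ∧ tv w j < b₂) := by
  simp only [mem_pi, mem_univ, true_imp_iff, mem_Ioo]
  constructor
  · intro h
    have hy := h (yIdx 2)
    have hi := h (tIdx i)
    have hj := h (tIdx j)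
    rw [show pt i j y₁ a₁ b₁ (yIdx 2) = yv (pt i j y₁ a₁ b₁) from rfl, yv_pt,
      show pt i j y₂ a₂ b₂ (yIdx 2) = yv (pt i j y₂ a₂ b₂) from rfl, yv_pt] at hy
    rw [show pt i j y₁ a₁ b₁ (tIdx i) = tv (pt i j y₁ a₁ b₁) i from rfl, tv_pt_i hij,
      show pt i j y₂ a₂ b₂ (tIdx i) = tv (pt i j y₂ a₂ b₂) i from rfl, tv_pt_i hij] at hi
    rw [show pt i j y₁ a₁ b₁ (tIdx j) = tv (pt i j y₁ a₁ b₁) j from rfl, tv_pt_j,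
      show pt i j y₂ a₂ b₂ (tIdx j) = tv (pt i j y₂ a₂ b₂) j from rfl, tv_pt_j] at hj
    exact ⟨hy, hi, hj⟩
  · rintro ⟨hy, hi, hj⟩ k
    rcases idx_cases k with rfl | ⟨q, rfl⟩
    · rw [show pt i j y₁ a₁ b₁ (yIdx 2) = yv (pt i j y₁ a₁ b₁) from rfl, yv_pt,
        show pt i j y₂ a₂ b₂ (yIdx 2) = yv (pt i j y₂ a₂ b₂) from rfl, yv_pt]
      exact hy
    · rcases fin_two_eq_or hij q with rfl | rfl
      · rw [show pt q j y₁ a₁ b₁ (tIdx q) = tv (pt q j y₁ a₁ b₁) q from rfl, tv_pt_i hij,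
          show pt q j y₂ a₂ b₂ (tIdx q) = tv (pt q j y₂ a₂ b₂) q from rfl, tv_pt_i hij]
        exact hi
      · rw [show pt i q y₁ a₁ b₁ (tIdx q) = tv (pt i q y₁ a₁ b₁) q from rfl, tv_pt_j,
          show pt i q y₂ a₂ b₂ (tIdx q) = tv (pt i q y₂ a₂ b₂) q from rfl, tv_pt_j]
        exact hj

/-- `w ↦ (y − l₀)⁻¹` is not integrable on a coordinate box `(l₀, l₀ + δ) × I₁ × I₂`. [folklore] -/
theorem not_integrableOn_inv_box (hij : i ≠ j) {l₀ δ a₁ a₂ b₁ b₂ : ℝ} (hδ : 0 < δ) (ha : a₁ < a₂)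
    (hb : b₁ < b₂) : ¬ IntegrableOn (fun w : Fin (0 + 1 + 2) → ℝ => (w (yIdx 2) - l₀)⁻¹)
      (Set.pi univ fun k => Ioo (pt i j l₀ a₁ b₁ k) (pt i j (l₀ + δ) a₂ b₂ k)) := by
  intro h2
  have hm1 : Measurable fun x : ℝ => (x - l₀)⁻¹ := (measurable_id.sub_const _).inv
  have hmid : pt i j (l₀ + δ / 2) ((a₁ + a₂) / 2) ((b₁ + b₂) / 2) ∈
      Set.pi univ (fun k => Ioo (pt i j l₀ a₁ b₁ k) (pt i j (l₀ + δ) a₂ b₂ k)) :=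
    (mem_box_pt hij _).2 ⟨⟨by rw [yv_pt]; linarith, by rw [yv_pt]; linarith⟩,
      ⟨by rw [tv_pt_i hij]; linarith, by rw [tv_pt_i hij]; linarith⟩,
      ⟨by rw [tv_pt_j]; linarith, by rw [tv_pt_j]; linarith⟩⟩
  have h3 : IntegrableOn (fun x : ℝ => (x - l₀)⁻¹) (Ioo (pt i j l₀ a₁ b₁ (yIdx 2)) (pt i j (l₀ + δ) a₂ b₂ (yIdx 2))) := by
    refine unletter_integrableOn_pi _ _ (yIdx 2) _ hm1 (fun k => ?_) (fun k => ?_) h2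
    · have hk := hmid k (mem_univ _)
      rw [Real.volume_Ioo, ENNReal.ofReal_ne_zero_iff]
      linarith [hk.1, hk.2]
    · rw [Real.volume_Ioo]; exact ENNReal.ofReal_ne_top
  have e1 : pt i j l₀ a₁ b₁ (yIdx 2) = l₀ := yv_pt (i := i) (j := j) l₀ a₁ b₁
  have e2 : pt i j (l₀ + δ) a₂ b₂ (yIdx 2) = l₀ + δ := yv_pt (i := i) (j := j) (l₀ + δ) a₂ b₂
  rw [e1, e2] at h3
  exact not_integrableOn_sub_inv hδ h3

/-- Arithmetic of the divergence bound: `y⁻¹ ≤ κ⁻¹ |K y⁻¹ p⁻¹ q⁻¹|` with `κ = |K|/(C₁ C₂)` when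
`0 < |p| ≤ C₁`, `0 < |q| ≤ C₂`. [folklore] -/
theorem inv_le_bound {K y p₁ q₁ C₁ C₂ : ℝ} (hK : K ≠ 0) (hy : 0 < y) (hp : 0 < |p₁|) (hq : 0 < |q₁|)
    (hC₁ : |p₁| ≤ C₁) (hC₂ : |q₁| ≤ C₂) :
    y⁻¹ ≤ (|K| / (C₁ * C₂))⁻¹ * |K * (1 / y) * ((1 / p₁) * (1 / q₁))| := by
  have hC₁0 : 0 < C₁ := hp.trans_le hC₁
  have hC₂0 : 0 < C₂ := hq.trans_le hC₂
  rw [abs_mul, abs_mul, abs_mul, abs_div, abs_div, abs_div, abs_one, abs_of_pos hy]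
  have e1 : 1 ≤ C₁ / |p₁| := (one_le_div hp).2 hC₁
  have e2 : 1 ≤ C₂ / |q₁| := (one_le_div hq).2 hC₂
  have e12 := one_le_mul_of_one_le_of_one_le e1 e2
  have hK' : |K| ≠ 0 := abs_ne_zero.2 hK
  have hp' : |p₁| ≠ 0 := hp.ne'
  have hq' : |q₁| ≠ 0 := hq.ne'
  calc y⁻¹ = 1 * y⁻¹ := (one_mul _).symm
    _ ≤ (C₁ / |p₁| * (C₂ / |q₁|)) * y⁻¹ := mul_le_mul_of_nonneg_right e12 (inv_nonneg.2 hy.le)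
    _ = (|K| / (C₁ * C₂))⁻¹ * (|K| * (1 / y) * ((1 / |p₁|) * (1 / |q₁|))) := by field_simp

/-- The letters do not meet the domain (non-zero base constant): at a point of the domain both
letter forms are non-zero. -/
theorem IsDN.letters_ne (h : IsDN s l u A B T p a i j) (hL : LData T a i j ci cj) (hK : Kc T p ≠ 0)
    {z : Fin (0 + 1 + 2) → ℝ} (hz : z ∈ s.domain) : tv z i ≠ ev ci (yv z) ∧ tv z j ≠ ev cj (yv z) := by
  obtain ⟨hnei, hnej⟩ := letter_ne_of_integrableOn h.ne _ A B T p a ci cj hL.hi hL.hj hL.n1 hL.n2 hK h.integrableOn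
  rw [← h.dom] at hnei hnej
  exact ⟨hnei z hz, hnej z hz⟩

/-- **A pole at the end forces a pinch.** If the base constant is non-zero and the base pole
sits at the left end `l`, then `A(l) = B(l)`. [Zagier 1994, §9] -/
theorem IsDN.pinch_of_pole (h : IsDN s l u A B T p a i j) (hL : LData T a i j ci cj) (hK : Kc T p ≠ 0)
    (hr : T.ℓ₂.2 = l) : evq A l = evq B l := by
  by_contra hne
  have hij := h.ne
  obtain ⟨hle, -⟩ := h.evq_le_ends
  have hlt : evq A l < evq B l := lt_of_le_of_ne hle hne
  -- constants
  set G : ℚ := evq B l - evq A l with hG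
  have hG0 : 0 < G := by rw [hG]; linarith
  set S : ℚ := |A.1 (Fin.last 0)| + |B.1 (Fin.last 0)| + 1 with hS
  have hS0 : 0 < S := by positivity
  set δ : ℚ := min ((u - l) / 2) (G / 8 / S) with hδ
  have hδ0 : 0 < δ := lt_min (by linarith [h.lu]) (by positivity)
  have hδ1 : l + δ < u := by have := min_le_left ((u - l) / 2) (G / 8 / S); rw [← hδ] at this; linarith
  have hδ2 : S * δ ≤ G / 8 := by
    have := min_le_right ((u - l) / 2) (G / 8 / S); rw [← hδ] at this
    calc S * δ ≤ S * (G / 8 / S) := mul_le_mul_of_nonneg_left this hS0.le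
      _ = G / 8 := by field_simp
  have hαδ : |A.1 (Fin.last 0)| * δ ≤ G / 8 := by
    have : |A.1 (Fin.last 0)| * δ ≤ S * δ := mul_le_mul_of_nonneg_right (by rw [hS]; linarith [abs_nonneg (B.1 (Fin.last 0))]) hδ0.le
    linarith
  have hβδ : |B.1 (Fin.last 0)| * δ ≤ G / 8 := by
    have : |B.1 (Fin.last 0)| * δ ≤ S * δ := mul_le_mul_of_nonneg_right (by rw [hS]; linarith [abs_nonneg (A.1 (Fin.last 0))]) hδ0.le
    linarith
  -- real versions
  have hδ0R : (0 : ℝ) < δ := by exact_mod_cast hδ0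
  have hG0R : (0 : ℝ) < G := by exact_mod_cast hG0
  have hαδR : |(A.1 (Fin.last 0) : ℝ)| * δ ≤ G / 8 := by rw [← Rat.cast_abs]; exact_mod_cast hαδ
  have hβδR : |(B.1 (Fin.last 0) : ℝ)| * δ ≤ G / 8 := by rw [← Rat.cast_abs]; exact_mod_cast hβδ
  have hGv : (evq B l : ℝ) = evq A l + G := by rw [hG]; push_cast; ring
  -- the band near `l`
  have hAy : ∀ y : ℝ, (l : ℝ) < y → y < l + δ → ev A y ≤ evq A l + G / 8 := fun y h1 h2 => by
    have hyl : |y - l| ≤ δ := by rw [abs_of_pos (by linarith)]; linarith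
    have := ev_sub_ev_le A (y := y) (y' := l) hyl
    rw [ev_ratCast] at this
    linarith
  have hBy : ∀ y : ℝ, (l : ℝ) < y → y < l + δ → (evq A l : ℝ) + 7 * G / 8 ≤ ev B y := fun y h1 h2 => by
    have hyl : |(l : ℝ) - y| ≤ δ := by rw [abs_of_neg (by linarith)]; linarith
    have := ev_sub_ev_le B (y := (l : ℝ)) (y' := y) hyl
    rw [ev_ratCast] at this
    linarith
  -- the box
  set t₀ : ℝ := (evq A l : ℝ) with ht₀
  set P : Set (Fin (0 + 1 + 2) → ℝ) := Set.pi univ (fun k => Ioo (pt i j (l : ℝ) (t₀ + 2 * G / 8) (t₀ + 5 * G / 8) k)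
    (pt i j ((l : ℝ) + δ) (t₀ + 3 * G / 8) (t₀ + 6 * G / 8) k)) with hP
  have hPm : MeasurableSet P := MeasurableSet.univ_pi fun _ => measurableSet_Ioo
  have hmemP : ∀ w ∈ P, ((l : ℝ) < yv w ∧ yv w < l + δ) ∧ (t₀ + 2 * G / 8 < tv w i ∧ tv w i < t₀ + 3 * G / 8) ∧
      (t₀ + 5 * G / 8 < tv w j ∧ tv w j < t₀ + 6 * G / 8) := fun w hw => (mem_box_pt hij w).1 hw
  have hPD : P ⊆ s.domain := fun w hw => by
    obtain ⟨⟨h1, h2⟩, ⟨h3, h4⟩, h5, h6⟩ := hmemP w hw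
    rw [h.mem]
    have := hAy _ h1 h2
    have := hBy _ h1 h2
    have hδu : (l : ℝ) + δ < u := by exact_mod_cast hδ1
    exact ⟨⟨h1, by linarith⟩, by linarith, by linarith, by linarith⟩
  have hintP : IntegrableOn (glitB T p a) P := by
    have := h.integrableOn
    rw [← h.dom] at this
    exact this.mono_set hPD
  -- the bound `(y - l)⁻¹ ≤ κ⁻¹ |f|` on the box
  set R : ℝ := max |(l : ℝ)| |(u : ℝ)| with hR
  set C₁ : ℝ := |t₀| + G + |(ci.2 : ℝ)| + 1 with hC₁
  set C₂ : ℝ := |t₀| + G + (|(cj.1 (Fin.last 0) : ℝ)| * R + |(cj.2 : ℝ)|) + 1 with hC₂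
  have hR0 : 0 ≤ R := le_max_of_le_left (abs_nonneg _)
  have hδu : (l : ℝ) + δ < u := by exact_mod_cast hδ1
  have hbound : ∀ w ∈ P, ‖(w (yIdx 2) - (l : ℝ))⁻¹‖ ≤ (|Kc T p| / (C₁ * C₂))⁻¹ * ‖glitB T p a w‖ := fun w hw => by
    obtain ⟨⟨h1, h2⟩, ⟨h3, h4⟩, h5, h6⟩ := hmemP w hw
    obtain ⟨hni, hnj⟩ := h.letters_ne hL hK (hPD hw)
    have hyl : 0 < yv w - l := by linarith
    -- bounds on the two letter factors
    have hyR : |yv w| ≤ R := cell_Ioo_bound l u _ ((mem_cell_Ioo l u _).2 ⟨h1, by linarith⟩)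
    have hti : |tv w i| ≤ |t₀| + G := by
      rw [abs_le]; constructor <;> linarith [neg_abs_le t₀, le_abs_self t₀]
    have htj : |tv w j| ≤ |t₀| + G := by
      rw [abs_le]; constructor <;> linarith [neg_abs_le t₀, le_abs_self t₀]
    have hb1 : |tv w i - ev ci (yv w)| ≤ C₁ := by
      rw [ev_of_fst_eq_zero hL.ci0]
      calc |tv w i - (ci.2 : ℝ)| ≤ |tv w i| + |(ci.2 : ℝ)| := abs_sub _ _
        _ ≤ C₁ := by rw [hC₁]; linarith
    have hb2 : |tv w j - ev cj (yv w)| ≤ C₂ := by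
      have := abs_ev_le_of cj hyR
      calc |tv w j - ev cj (yv w)| ≤ |tv w j| + |ev cj (yv w)| := abs_sub _ _
        _ ≤ C₂ := by rw [hC₂]; linarith
    rw [Real.norm_eq_abs, Real.norm_eq_abs, show w (yIdx 2) = yv w from rfl, abs_inv, abs_of_pos hyl,
      glitB_two T p a hij ci cj hL.hi hL.hj hL.n1 hL.n2, hr]
    exact inv_le_bound hK hyl (abs_pos.2 (sub_ne_zero.2 hni)) (abs_pos.2 (sub_ne_zero.2 hnj)) hb1 hb2
  have hm1 : Measurable fun x : ℝ => (x - (l : ℝ))⁻¹ := (measurable_id.sub_const _).inv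
  have h2 : IntegrableOn (fun w : Fin (0 + 1 + 2) → ℝ => (w (yIdx 2) - (l : ℝ))⁻¹) P :=
    Integrable.mono' (hintP.norm.const_mul _) ((hm1.comp (measurable_pi_apply _)).aestronglyMeasurable)
      ((ae_restrict_iff' hPm).2 (Filter.Eventually.of_forall hbound))
  exact not_integrableOn_inv_box hij hδ0R (by linarith) (by linarith) h2

/-! ### A pinch with both letters off the vertex -/

/-- Rational bookkeeping of `good_pinch_far`. [folklore] -/
theorem far_arith {α β lam η S δ : ℚ} (hS : S = |α| + |β| + |lam| + 1) (hδ0 : 0 ≤ δ) (hSδ : S * δ ≤ η / 4) :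
    |α| * δ ≤ η / 4 ∧ |β| * δ ≤ η / 4 ∧ |lam| * δ ≤ η / 4 := by
  have e : S * δ = |α| * δ + |β| * δ + |lam| * δ + δ := by rw [hS]; ring
  rw [e] at hSδ
  have h1 : 0 ≤ |α| * δ := by positivity
  have h2 : 0 ≤ |β| * δ := by positivity
  have h3 : 0 ≤ |lam| * δ := by positivity
  exact ⟨by linarith, by linarith, by linarith⟩

/-- **A pinch with both letters off the vertex, pole off the closed interval.** If the band
pinches at the left end (`A(l) = B(l) = t₀`), the right end is regular, the pole is off the
closed interval and both letters miss the vertex (`cᵢ ≠ t₀`, `cⱼ(l) ≠ t₀`), the datum is good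
given `HPar1`. [Kontsevich–Zagier 2001, §1.2, rules (1a), (2)] -/
theorem IsDN.good_pinch_far (h : IsDN s l u A B T p a i j) (hL : LData T a i j ci cj) (hP : HParS T p a i j ci cj)
    (hK : Kc T p ≠ 0) (hpinch : evq A l = evq B l) (hreg : evq A u < evq B u) (hr : T.ℓ₂.2 < l ∨ u < T.ℓ₂.2)
    (hci : ci.2 ≠ evq A l) (hcj : evq cj l ≠ evq A l) : Good 2 (KZ.of s) := by
  have hij := h.ne
  have hadm : T.n₁ = 0 ∨ T.n₂ = 0 := Or.inl hL.n1
  -- constants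
  set t₀ : ℚ := evq A l with ht₀
  set η : ℚ := min |ci.2 - t₀| |evq cj l - t₀| with hη
  have hη0 : 0 < η := lt_min (abs_pos.2 (sub_ne_zero.2 hci)) (abs_pos.2 (sub_ne_zero.2 hcj))
  have hη1 : η ≤ |ci.2 - t₀| := min_le_left _ _
  have hη2 : η ≤ |evq cj l - t₀| := min_le_right _ _
  set α : ℚ := A.1 (Fin.last 0) with hα
  set β : ℚ := B.1 (Fin.last 0) with hβ
  set lam : ℚ := cj.1 (Fin.last 0) with hlam
  set S : ℚ := |α| + |β| + |lam| + 1 with hS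
  have hS0 : 0 < S := by positivity
  set δ : ℚ := min ((u - l) / 2) (η / 4 / S) with hδ
  have hδ0 : 0 < δ := lt_min (by linarith [h.lu]) (by positivity)
  have hlq : l < l + δ := by linarith
  have hqu : l + δ < u := by have := min_le_left ((u - l) / 2) (η / 4 / S); rw [← hδ] at this; linarith
  have hSδ : S * δ ≤ η / 4 := by
    have := min_le_right ((u - l) / 2) (η / 4 / S); rw [← hδ] at this
    calc S * δ ≤ S * (η / 4 / S) := mul_le_mul_of_nonneg_left this hS0.le
      _ = η / 4 := by field_simp
  obtain ⟨hαδ, hβδ, hlamδ⟩ := far_arith hS hδ0.le hSδ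
  set Tc : ℚ := t₀ - η / 2 with hTc
  -- cut the base at `l + δ`; the right piece is regular
  refine h.good_split (l + δ) hlq hqu (fun s₁ h₁ => ?_) fun s₂ h₂ =>
    h₂.good_middle hL hP hK (h.evq_lt hlq hqu) hreg (hr.imp_left fun hr => hr.trans hlq)
  -- real bookkeeping on the left piece
  have hη0R : (0 : ℝ) < η := by exact_mod_cast hη0
  have hαδR : |(α : ℝ)| * δ ≤ η / 4 := by rw [← Rat.cast_abs]; exact_mod_cast hαδ
  have hβδR : |(β : ℝ)| * δ ≤ η / 4 := by rw [← Rat.cast_abs]; exact_mod_cast hβδ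
  have hlamδR : |(lam : ℝ)| * δ ≤ η / 4 := by rw [← Rat.cast_abs]; exact_mod_cast hlamδ
  have hBl : (evq B l : ℝ) = t₀ := by exact_mod_cast hpinch.symm
  have hAy : ∀ y : ℝ, (l : ℝ) < y → y < l + δ → (t₀ : ℝ) - η / 4 ≤ ev A y := fun y h1 h2 => by
    have hyl : |(l : ℝ) - y| ≤ δ := by rw [abs_of_neg (by linarith)]; linarith
    have := ev_sub_ev_le A (y := (l : ℝ)) (y' := y) hyl
    rw [ev_ratCast] at this
    linarith
  have hBy : ∀ y : ℝ, (l : ℝ) < y → y < l + δ → ev B y ≤ (t₀ : ℝ) + η / 4 := fun y h1 h2 => by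
    have hyl : |y - l| ≤ δ := by rw [abs_of_pos (by linarith)]; linarith
    have := ev_sub_ev_le B (y := y) (y' := l) hyl
    rw [ev_ratCast, hBl] at this
    linarith
  have hCy : ∀ y : ℝ, (l : ℝ) < y → y < l + δ → |ev cj y - evq cj l| ≤ η / 4 := fun y h1 h2 => by
    have hyl : |y - l| ≤ δ := by rw [abs_of_pos (by linarith)]; linarith
    have hyl' : |(l : ℝ) - y| ≤ δ := by rw [abs_sub_comm]; exact hyl
    have e1 := ev_sub_ev_le cj (y := y) (y' := l) hyl
    have e2 := ev_sub_ev_le cj (y := (l : ℝ)) (y' := y) hyl'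
    rw [ev_ratCast] at e1 e2
    rw [abs_le]; constructor <;> linarith
  -- the section against the band
  have hTA : ∀ y : ℝ, (l : ℝ) < y → y < l + δ → ev (RebaseZero.mk 0 Tc) y < ev A y := fun y h1 h2 => by
    rw [ev_mk_zero, hTc]; push_cast; linarith [hAy y h1 h2]
  -- the letters against the box `(Tc, B)`
  have hgi : ∀ z : Fin (0 + 1 + 2) → ℝ, (l : ℝ) < yv z → yv z < l + δ → (Tc : ℝ) < tv z i → tv z i < ev B (yv z) →
      (η : ℝ) / 2 ≤ |tv z i - ev ci (yv z)| := fun z h1 h2 h3 h4 => by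
    rw [ev_of_fst_eq_zero hL.ci0]
    have hB' := hBy _ h1 h2
    have hTc' : ((Tc : ℚ) : ℝ) = t₀ - η / 2 := by rw [hTc]; push_cast; ring
    rw [hTc'] at h3
    have hη1R : (η : ℝ) ≤ |(ci.2 : ℝ) - t₀| := by rw [← Rat.cast_sub, ← Rat.cast_abs]; exact_mod_cast hη1
    rcases le_or_gt (ci.2 : ℝ) t₀ with hc | hc
    · rw [abs_of_nonpos (by linarith)] at hη1R
      rw [abs_of_pos (by linarith)]; linarith
    · rw [abs_of_pos (by linarith)] at hη1R
      rw [abs_of_neg (by linarith)]; linarith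
  have hgj : ∀ z : Fin (0 + 1 + 2) → ℝ, (l : ℝ) < yv z → yv z < l + δ → (Tc : ℝ) < tv z j → tv z j < ev B (yv z) →
      (η : ℝ) / 4 ≤ |tv z j - ev cj (yv z)| := fun z h1 h2 h3 h4 => by
    have hB' := hBy _ h1 h2
    have hC' := hCy _ h1 h2
    have hTc' : ((Tc : ℚ) : ℝ) = t₀ - η / 2 := by rw [hTc]; push_cast; ring
    rw [hTc'] at h3
    have hη2R : (η : ℝ) ≤ |(evq cj l : ℝ) - t₀| := by rw [← Rat.cast_sub, ← Rat.cast_abs]; exact_mod_cast hη2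
    obtain ⟨hC1, hC2⟩ := abs_le.1 hC'
    rcases le_or_gt (evq cj l : ℝ) t₀ with hc | hc
    · rw [abs_of_nonpos (by linarith)] at hη2R
      rw [abs_of_pos (by linarith)]; linarith
    · rw [abs_of_pos (by linarith)] at hη2R
      rw [abs_of_neg (by linarith)]; linarith
  -- the box converges
  obtain ⟨ρ, hρ, hρle⟩ : ∃ ρ : ℝ, 0 < ρ ∧ ∀ y : ℝ, (l : ℝ) < y → y < l + δ → ρ ≤ |y - T.ℓ₂.2| := by
    rcases hr with hr | hr
    · have hr' : (T.ℓ₂.2 : ℝ) < l := by exact_mod_cast hr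
      refine ⟨l - T.ℓ₂.2, by linarith, fun y h1 _ => ?_⟩
      rw [abs_of_pos (by linarith)]; linarith
    · have hr' : (u : ℝ) < T.ℓ₂.2 := by exact_mod_cast hr
      have hqu' : (l : ℝ) + δ < u := by exact_mod_cast hqu
      refine ⟨T.ℓ₂.2 - u, by linarith, fun y _ h2 => ?_⟩
      rw [abs_of_neg (by linarith)]; linarith
  have hWW : IntegrableOn (glitB T p a)
      (gDom 0 2 2 ![RebaseZero.mk 1 (-l), RebaseZero.mk (-1) (l + δ)] (nlo i (RebaseZero.mk 0 Tc)) (nhi j B)) := by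
    refine integrableOn_of_abs_le (isSemialgebraic_gDom _ _ _ _) (isBounded_nDom_Ioo hij l (l + δ) _ _)
      (isSemialgebraicFunOn_glit (isSemialgebraic_gDom _ _ _ _) _ _ _ _ _ _ _ _)
      (|Kc T p| / (ρ * (η / 2) * (η / 4))) fun z hz => ?_
    rw [mem_nDom_Ioo hij, ev_mk_zero] at hz
    obtain ⟨⟨h1, h2⟩, h3, h4, h5⟩ := hz
    push_cast at h2
    exact abs_glitB_le hL p z hρ (by positivity) (by positivity) (hρle _ h1 h2) (hgi z h1 h2 h3 (h4.trans h5))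
      (hgj z h1 h2 (h3.trans h4) h5)
  have fT : (RebaseZero.mk 0 Tc).1 (Fin.last 0) = ci.1 (Fin.last 0) := by rw [mk_fst, hL.ci0]
  have hTA' : ∀ y : ℝ, (l : ℝ) < y → y < ((l + δ : ℚ) : ℝ) → ev (RebaseZero.mk 0 Tc) y < ev A y := fun y h1 h2 =>
    hTA y h1 (by push_cast at h2; exact h2)
  exact h₁.good_sub hadm (RebaseZero.mk 0 Tc) hTA' hWW (fun W hW' => hW'.good_par hP (Or.inl fT))
    fun r₁ hr₁ => hr₁.good_par hP (Or.inl fT)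

/-! ### The residual hypothesis at the left end -/

/-- **The residual vertex hypothesis `HVertL` on structured data**: a datum of `HDiff₁` with
non-zero base constant whose band pinches at the LEFT end `l` (`A(l) = B(l) = t₀`), with the
pole AT the vertex (`r = l`) or a letter THROUGH the vertex (`cᵢ = t₀` or `cⱼ(l) = t₀`), whose
right end is regular and whose pole is off `(l, u]`, is good for `GG 0 2 2`.
[Kontsevich–Zagier 2001, §1.2] -/
def HVertLS (T : BData) (p : MvPolynomial (Fin 0) ℚ) (a : Fin 2 → Option Cf) (i j : Fin 2) (ci cj : Cf) : Prop :=
  ∀ (s : KZ.IntegralRep (0 + 1 + 2)) (l u : ℚ) (A B : Cf), IsDN s l u A B T p a i j → Kc T p ≠ 0 →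
    evq A l = evq B l → (T.ℓ₂.2 = l ∨ ci.2 = evq A l ∨ evq cj l = evq A l) → evq A u < evq B u →
    (T.ℓ₂.2 ≤ l ∨ u < T.ℓ₂.2) → Good 2 (KZ.of s)

/-- **The left end.** A datum of `HDiff₁` whose left end is singular (pinch or pole) and whose
right end is regular (no pinch, pole off `(l, u]`) is good, given `HPar1` and `HVertL`.
[Kontsevich–Zagier 2001, §1.2] -/
theorem IsDN.good_left_of_HVertL (h : IsDN s l u A B T p a i j) (hL : LData T a i j ci cj) (hP : HParS T p a i j ci cj)
    (hV : HVertLS T p a i j ci cj) (hsing : evq A l = evq B l ∨ T.ℓ₂.2 = l) (hreg : evq A u < evq B u)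
    (hr : T.ℓ₂.2 ≤ l ∨ u < T.ℓ₂.2) : Good 2 (KZ.of s) := by
  by_cases hK : Kc T p = 0
  · exact h.good_zero hK
  have hpinch : evq A l = evq B l := hsing.elim id fun hp => h.pinch_of_pole hL hK hp
  by_cases hv : T.ℓ₂.2 = l ∨ ci.2 = evq A l ∨ evq cj l = evq A l
  · exact hV s l u A B h hK hpinch hv hreg hr
  · push Not at hv
    obtain ⟨hv1, hv2, hv3⟩ := hv
    exact h.good_pinch_far hL hP hK hpinch hreg (hr.imp_left fun h' => lt_of_le_of_ne h' hv1) hv2 hv3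

end RebaseE1

/-- **Registered brick `rebaseSimpleZero_E1poleEnd`** (part `rebaseSimpleZero_HDiff1_of_HPar1` of
`stub_rebaseSimpleZeroTwo`, line `janus-bands`): a base pole at the end of the interval forces
a pinch. For a datum of the interval normal form `HDiff₁` (`RebaseE1.IsDN`) with non-zero base
constant whose base pole sits at the left end `l`, the band pinches there, `A(l) = B(l)`
(`RebaseE1.IsDN.pinch_of_pole`: otherwise a coordinate box inside the domain carries the bound
`(y − l)⁻¹ ≤ C |f|` and `∫ dy/(y − l)` diverges). [Zagier 1994, §9] -/
theorem rebaseSimpleZero_E1poleEnd (i j : Fin 2) (s : KZ.IntegralRep (0 + 1 + 2)) (l u : ℚ) (A B ci cj : (Fin (0 + 1) → ℚ) × ℚ) (T : RebaseZero.BData) (p : MvPolynomial (Fin 0) ℚ) (a : Fin 2 → Option ((Fin (0 + 1) → ℚ) × ℚ)) (h : RebaseE1.IsDN s l u A B T p a i j) (hL : RebaseE1.LData T a i j ci cj) (hK : RebaseDiff.Kc T p ≠ 0) (hr : T.ℓ₂.2 = l) : RebaseE1.evq A l = RebaseE1.evq B l :=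
  h.pinch_of_pole hL hK hr

end Summit.KontsevichZagierPeriods.ArrangementNormalForm.JanusBands
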